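/-
Copyright (c) 2026 the pub-hodgecm-mathlib formalisation cell (harness21).  Prover seat hodgecm-mathlib-LH3-p04 (g3): LH3 «Transf» road,
organ (M2) `hcont` ∕ (I₁)-half of (SB-TRANSF) (dealer LH3-plan (g3) board #1 (i) 2026-09-02), the `hb` input of the corner gluing.
-/
import Literature.NumberTheory.Rogawski1990.ArchTransfFamilyResolved             -- LH3-p04 (g3): `transfFamReg_eq_unit_mul_sum`, `contDiff_unit`, `contDiff_archERhoG_slotPerm`, `exists_continuousLinearEquiv_eq_slotPerm`
import Literature.Analysis.Calculus.BoundedJetsLeibnizReflection                  -- ★ p850096 F0P3a-p02 (g19): `bddAbove_norm_iteratedFDeriv_mul∕_add∕_of_isCompact∕_comp_affine`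
import Literature.Analysis.Calculus.SmoothGluingAcrossHyperplaneArrangement       -- ★ p850123 LH3-p04 (g3): `iteratedFDeriv_eq_of_eqOn_isOpen`
import HarnessLib

/-!
# (I₁)-shape jet bounds for the partner sum `transfFamReg` on `K ∩ RegG S` (Bouaziz 1994 §3.2 (I₁) p. 579; Shelstad 1979 §4 p. 23; Rogawski 1990 §4.3 p. 43)

Topic `NumberTheory/Rogawski1990`; namespace `Literature.NumberTheory.Rogawski1990`.  THEOREMS ONLY (no `def`, no instance, no notation, no axiom, no named fact,
no `sorry`); kernel lane `--supports stmt-HodgeConjecture-24833`.  Cell `pub/hodgecm-mathlib`, crux H413 (`stmt-HodgeConjecture-24833`), F0∕P3c line LH3 (closer stub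
`stub_N9`, DIRECT ROAD «Transf», organ O-L2 `stub_N9transf`); sibling of `ArchTransfFamilyResolved.lean` (LH3-p04 (g3), pieces (0)+(2) of the (M2)∕(I₁) cut).

WHAT IS PROVED.  Bouaziz's (I₁) «`sup_{K ∩ H_reg} |∂(u)ψ_H| < ∞` for every compact `K` and every invariant differential operator `u`» for the `Δ″`-weighted partner sum:
**for every compact `K` and every order `n`, `‖Dⁿ(transfFamReg L α μ F S)‖` is bounded on `K ∩ RegG S`** (`bddAbove_norm_iteratedFDeriv_transfFamReg`), given HC's (I₁) for
`F S` on ★ `InRegG (slotSign L α) S` (smoothness + bounded jets on `K′ ∩ InRegG`, the two halves of ★ `ArchHcSmoothOneSided`), for an admissible chart `S` under the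
`μ`-guard.  Mechanism: on the open set `RegG S` the partner sum IS the resolved form `Φ_k = w_S·Ũ_k·Σ_ρ (K_ρσ_ρ)·(archERhoG S∘slotPerm ρ)·(F S∘slotPerm ρ)` of the sibling
file (entire unit coefficients), so its jets are those of `Φ_k` (★ `iteratedFDeriv_eq_of_eqOn_isOpen`); Leibniz on the piece `K ∩ RegG S` (★ `bddAbove_norm_iteratedFDeriv_mul`,
F0P3a-p02 (g19)) with the jets of the entire factors bounded on the compact `K`, and the jets of `F S ∘ slotPerm ρ` bounded through the linear change of variables
(★ `bddAbove_norm_iteratedFDeriv_comp_affine`) by HC's bound on the compact `slotPerm ρ '' K` intersected with `InRegG` (the partner points of `RegG S` are `G`-regular).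
No blow-up at the `H`-walls: `Ũ_k` is a unit there too.  This is the `hb` input of the corner gluing ★ `contDiffOn_extendFrom_of_arrangement` (p850123) in the assembly
`ArchTransfFamilySmoothInRegS.lean`, and — once `transfFam` is known `C^∞` on `InRegS S` — the (I₁) half of ★ `ArchBzSmoothBounded (transfFam …)` by density of `RegG S`.
§1 is the generic finite-sum companion of ★ `bddAbove_norm_iteratedFDeriv_add`.

HONEST LABEL: HC_CM is proved only modulo the 7 printed citations (2 remaining: hLiu418 = `stmt-HodgeConjecture-24832`, h413 = `stmt-HodgeConjecture-24833`) until rung 0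
closes; count-neutral calculus under O-L2, pays no organ by itself.

## References
* [Bouaziz1994IntegralesOrbitales] A. Bouaziz, *Intégrales orbitales sur les groupes de Lie réductifs*, Ann. Sci. ÉNS 27 (1994), §3.2 (I₁) p. 579.
* [Shelstad1979] D. Shelstad, *Characters and inner forms of a quasi-split group over ℝ*, Compositio Math. 39 (1979), §4 p. 23 ((I) «bounded on compact subsets»).
* [Rogawski1990] J. D. Rogawski, *Automorphic Representations of Unitary Groups in Three Variables*, Ann. of Math. Stud. 123 (1990), §4.3 (4.3.1) p. 43.
-/

set_option autoImplicit false

noncomputable section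

open NumberField NumberField.InfinitePlace Complex Equiv Finset Filter Topology Set
open scoped MatrixGroups ComplexConjugate Classical ContDiff
open Literature.NumberTheory.Automorphic Literature.NumberTheory.Automorphic.UnitaryGroup Literature.NumberTheory.Automorphic.ArchCartan
open Literature.NumberTheory.GaloisRepresentations Literature.Analysis.Calculus

namespace Literature.NumberTheory.Rogawski1990

/-! ## §1 Bounded jets of a finite sum and of a constant (generic) -/

section Generic

variable {E : Type*} [NormedAddCommGroup E] [NormedSpace ℝ E] {F' : Type*} [NormedAddCommGroup F'] [NormedSpace ℝ F']

/-- **Bounded jets of a finite sum** (★ `bddAbove_norm_iteratedFDeriv_add` iterated). [cite: Bouaziz1994IntegralesOrbitales, §3.2 (I₁) p. 579] -/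
theorem bddAbove_norm_iteratedFDeriv_finset_sum {ι : Type*} {O A : Set E} (hO : IsOpen O) (hAO : A ⊆ O) {g : ι → E → F'} (P : Finset ι)
    (hg : ∀ i ∈ P, ContDiffOn ℝ ∞ (g i) O) {n : ℕ} (hb : ∀ i ∈ P, BddAbove ((fun y => ‖iteratedFDeriv ℝ n (g i) y‖) '' A)) :
    BddAbove ((fun y => ‖iteratedFDeriv ℝ n (fun y => ∑ i ∈ P, g i y) y‖) '' A) := by
  classical
  induction P using Finset.induction_on with
  | empty =>
    refine ⟨0, ?_⟩
    rintro _ ⟨y, _, rfl⟩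
    simp only [Finset.sum_empty, iteratedFDeriv_fun_zero, Pi.zero_apply, norm_zero, le_refl]
  | insert i P hi IH =>
    have h : (fun y => ∑ j ∈ insert i P, g j y) = g i + fun y => ∑ j ∈ P, g j y := by
      funext y; rw [Finset.sum_insert hi]; rfl
    rw [h]
    exact bddAbove_norm_iteratedFDeriv_add hO hAO (hg i (Finset.mem_insert_self i P))
      (ContDiffOn.sum fun j hj => hg j (Finset.mem_insert_of_mem hj)) (hb i (Finset.mem_insert_self i P))
      (IH (fun j hj => hg j (Finset.mem_insert_of_mem hj)) fun j hj => hb j (Finset.mem_insert_of_mem hj))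

/-- The jets of an ENTIRE function are bounded on every subset of a compact set. [cite: Bouaziz1994IntegralesOrbitales, §3.2 (I₁) p. 579] -/
theorem bddAbove_norm_iteratedFDeriv_of_contDiff_of_subset_isCompact {g : E → F'} (hg : ContDiff ℝ ∞ g) {K A : Set E} (hK : IsCompact K) (hAK : A ⊆ K) (i : ℕ) :
    BddAbove ((fun y => ‖iteratedFDeriv ℝ i g y‖) '' A) :=
  (bddAbove_norm_iteratedFDeriv_of_isCompact isOpen_univ hK (subset_univ K) hg.contDiffOn i).mono (image_mono hAK)

end Generic

/-! ## §2 The (I₁) bound for the partner sum on `K ∩ RegG S` -/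

section Transf

variable (L : Type) [Field L] [NumberField L] [IsCMField L] (α : Fin 3 → L) (μ : HeckeCharacter L)

omit [IsCMField L] in
/-- **Bounded jets of `F S ∘ slotPerm ρ` on `K ∩ RegG S`** from HC's (I₁) bound for `F S` on `slotPerm ρ '' K ∩ InRegG` (a compact meeting `T_{in-reg}(G′)`): the partner points of a
`G`-regular point are `G`-regular, and jets transform through the linear automorphism `slotPerm ρ` (★ `bddAbove_norm_iteratedFDeriv_comp_affine`).
[cite: Bouaziz1994IntegralesOrbitales, §3.2 (I₁) p. 579] [cite: Shelstad1979, §4 (I) p. 23] -/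
theorem bddAbove_norm_iteratedFDeriv_comp_slotPerm (S : Finset {w : InfinitePlace L // IsComplex w})
    {F : Finset {w : InfinitePlace L // IsComplex w} → ({w : InfinitePlace L // IsComplex w} → Fin 3 → ℝ) → ℂ}
    (hI1b : ∀ (n : ℕ) (K : Set ({w : InfinitePlace L // IsComplex w} → Fin 3 → ℝ)), IsCompact K →
      BddAbove ((fun c => ‖iteratedFDeriv ℝ n (F S) c‖) '' (K ∩ InRegG (slotSign L α) S)))
    {ρ : {w : InfinitePlace L // IsComplex w} → Perm (Fin 3)} (hρ : ρ ∈ partnerPerms S) (n : ℕ)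
    {K : Set ({w : InfinitePlace L // IsComplex w} → Fin 3 → ℝ)} (hK : IsCompact K) :
    BddAbove ((fun c => ‖iteratedFDeriv ℝ n (fun c => F S (slotPerm ρ c)) c‖) '' (K ∩ RegG S)) := by
  obtain ⟨P, hP⟩ := exists_continuousLinearEquiv_eq_slotPerm ρ
  have hfun : (fun c : {w : InfinitePlace L // IsComplex w} → Fin 3 → ℝ => F S (slotPerm ρ c)) = fun c => F S (P c + 0) := by
    funext c; rw [add_zero, hP]
  rw [hfun]
  refine bddAbove_norm_iteratedFDeriv_comp_affine P 0 ((hI1b n (P '' K) (hK.image P.continuous)).mono (image_mono ?_))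
  rintro _ ⟨c, hc, rfl⟩
  refine ⟨⟨c, hc.1, by simp only [add_zero]⟩, ?_⟩
  show P c + 0 ∈ InRegG (slotSign L α) S
  rw [add_zero, hP]
  exact regG_subset_inRegG (slotSign L α) S ((slotPerm_mem_regG_iff hρ c).2 hc.2)

/-- **(I₁) FOR THE PARTNER SUM: for every compact `K` and order `n`, `‖Dⁿ(transfFamReg L α μ F S)‖` is bounded on `K ∩ RegG S`** (admissible `S`, `μ`-guard, HC's (I₁) for `F S`:
`C^∞` on ★ `InRegG (slotSign L α) S` with jets bounded on `K′ ∩ InRegG`).  No blow-up at the `H`-walls or the real walls: the coefficients of the resolved form are entire units.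
[cite: Bouaziz1994IntegralesOrbitales, §3.2 (I₁) p. 579] [cite: Shelstad1979, §4 (I) p. 23] [cite: Rogawski1990, §4.3 (4.3.1) p. 43] -/
theorem bddAbove_norm_iteratedFDeriv_transfFamReg
    (hμω : ∀ x : ideleGroup ↥(maximalRealSubfield L), μ (AdeleRing.ideleBaseChange (↥(maximalRealSubfield L)) L x) = quadraticHeckeCharCM L x)
    {S : Finset {w : InfinitePlace L // IsComplex w}} (hS : ∀ w ∈ S, w ∈ splitChartPlaces L α)
    {F : Finset {w : InfinitePlace L // IsComplex w} → ({w : InfinitePlace L // IsComplex w} → Fin 3 → ℝ) → ℂ}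
    (hI1 : ContDiffOn ℝ ∞ (F S) (InRegG (slotSign L α) S))
    (hI1b : ∀ (n : ℕ) (K : Set ({w : InfinitePlace L // IsComplex w} → Fin 3 → ℝ)), IsCompact K →
      BddAbove ((fun c => ‖iteratedFDeriv ℝ n (F S) c‖) '' (K ∩ InRegG (slotSign L α) S)))
    (n : ℕ) {K : Set ({w : InfinitePlace L // IsComplex w} → Fin 3 → ℝ)} (hK : IsCompact K) :
    BddAbove ((fun c => ‖iteratedFDeriv ℝ n (transfFamReg L α μ F S) c‖) '' (K ∩ RegG S)) := by
  obtain ⟨k, hk⟩ := exists_archTau_mul_archWeylRatio_endoTorus_eq L μ hμω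
  -- the resolved form `Φ_k` and its agreement with `transfFamReg` on the open set `RegG S`
  set Φ : ({w : InfinitePlace L // IsComplex w} → Fin 3 → ℝ) → ℂ := fun c =>
      (partnerWeight L α S *
        ∏ w : {w : InfinitePlace L // IsComplex w}, (if w ∈ S then Complex.exp (((2 * k w + 1 : ℤ) : ℂ) * ((c w 2 : ℂ) * I))
          else (((Circle.exp (c w 0) : ℂ) * Circle.exp (c w 2)) ^ (k w)) * (Circle.exp (c w 2) : ℂ))) *
      ∑ ρ ∈ partnerPerms S,
        (((∏ w : {w : InfinitePlace L // IsComplex w},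
            ((SignType.sign ((w.1.embedding (α (lineOf (formSign L α w) ((ρ w).symm 1)))).re) : ℤ) * archMajoritySign L (Matrix.diagonal α) w) : ℤ) : ℂ) *
          ∏ w : {w : InfinitePlace L // IsComplex w}, (Equiv.Perm.sign (ρ w) : ℂ)) *
        (archERhoG S (slotPerm ρ c) * F S (slotPerm ρ c)) with hΦdef
  have hO : IsOpen (RegG S) := isOpen_regG S
  have hAO : K ∩ RegG S ⊆ RegG S := inter_subset_right
  have hAK : K ∩ RegG S ⊆ K := inter_subset_left
  have heq : EqOn (transfFamReg L α μ F S) Φ (RegG S) := fun c hc => transfFamReg_eq_unit_mul_sum L α μ hS F k (hk S) hc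
  -- it suffices to bound the jets of `Φ`
  suffices h : BddAbove ((fun c => ‖iteratedFDeriv ℝ n Φ c‖) '' (K ∩ RegG S)) by
    obtain ⟨C, hC⟩ := h
    refine ⟨C, ?_⟩
    rintro _ ⟨c, hc, rfl⟩
    dsimp only
    rw [iteratedFDeriv_eq_of_eqOn_isOpen hO heq hc.2 n]
    exact mem_upperBounds.1 hC _ ⟨c, hc, rfl⟩
  -- smoothness of the pieces on `RegG S`
  have hf : ∀ ρ ∈ partnerPerms S, ContDiffOn ℝ ∞ (fun c : {w : InfinitePlace L // IsComplex w} → Fin 3 → ℝ => F S (slotPerm ρ c)) (RegG S) := by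
    intro ρ hρ
    obtain ⟨P, hP⟩ := exists_continuousLinearEquiv_eq_slotPerm ρ
    have hcomp : (fun c : {w : InfinitePlace L // IsComplex w} → Fin 3 → ℝ => F S (slotPerm ρ c)) = F S ∘ P := by
      funext c; rw [Function.comp_apply, hP]
    rw [hcomp]
    exact hI1.comp P.contDiff.contDiffOn fun c hc => by
      rw [hP]; exact regG_subset_inRegG (slotSign L α) S ((slotPerm_mem_regG_iff hρ c).2 hc)
  have hterm : ∀ ρ ∈ partnerPerms S, ContDiffOn ℝ ∞ (fun c : {w : InfinitePlace L // IsComplex w} → Fin 3 → ℝ =>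
      (((∏ w : {w : InfinitePlace L // IsComplex w},
          ((SignType.sign ((w.1.embedding (α (lineOf (formSign L α w) ((ρ w).symm 1)))).re) : ℤ) * archMajoritySign L (Matrix.diagonal α) w) : ℤ) : ℂ) *
        ∏ w : {w : InfinitePlace L // IsComplex w}, (Equiv.Perm.sign (ρ w) : ℂ)) *
      (archERhoG S (slotPerm ρ c) * F S (slotPerm ρ c))) (RegG S) :=
    fun ρ hρ => contDiffOn_const.mul ((contDiff_archERhoG_slotPerm S ρ).contDiffOn.mul (hf ρ hρ))
  -- Leibniz: prefactor × sum
  refine bddAbove_norm_iteratedFDeriv_mul hO hAO ((contDiff_const.mul (contDiff_unit S k)).contDiffOn) (ContDiffOn.sum hterm)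
    (fun i _ => bddAbove_norm_iteratedFDeriv_of_contDiff_of_subset_isCompact (contDiff_const.mul (contDiff_unit S k)) hK hAK i) (fun i _ => ?_)
  -- the sum, term by term
  refine bddAbove_norm_iteratedFDeriv_finset_sum hO hAO (partnerPerms S) hterm fun ρ hρ => ?_
  -- constant × (twist × family)
  refine bddAbove_norm_iteratedFDeriv_mul hO hAO contDiffOn_const ((contDiff_archERhoG_slotPerm S ρ).contDiffOn.mul (hf ρ hρ))
    (fun j _ => bddAbove_norm_iteratedFDeriv_of_contDiff_of_subset_isCompact contDiff_const hK hAK j) (fun j _ => ?_)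
  exact bddAbove_norm_iteratedFDeriv_mul hO hAO (contDiff_archERhoG_slotPerm S ρ).contDiffOn (hf ρ hρ)
    (fun l _ => bddAbove_norm_iteratedFDeriv_of_contDiff_of_subset_isCompact (contDiff_archERhoG_slotPerm S ρ) hK hAK l)
    (fun l _ => bddAbove_norm_iteratedFDeriv_comp_slotPerm L α S hI1b hρ l hK)

/-- The same with the full HC space ★ `ArchHCSpaceG` as hypothesis (its (I₁) clause supplies both inputs). [cite: Bouaziz1994IntegralesOrbitales, §3.2 (I₁) p. 579] -/
theorem bddAbove_norm_iteratedFDeriv_transfFamReg_of_hc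
    (hμω : ∀ x : ideleGroup ↥(maximalRealSubfield L), μ (AdeleRing.ideleBaseChange (↥(maximalRealSubfield L)) L x) = quadraticHeckeCharCM L x)
    {S : Finset {w : InfinitePlace L // IsComplex w}} (hS : ∀ w ∈ S, w ∈ splitChartPlaces L α)
    {jc' : Finset {w : InfinitePlace L // IsComplex w} → {w : InfinitePlace L // IsComplex w} → Fin 3 → Fin 3 → ℂ}
    {F : Finset {w : InfinitePlace L // IsComplex w} → ({w : InfinitePlace L // IsComplex w} → Fin 3 → ℝ) → ℂ} (hF : ArchHCSpaceG (slotSign L α) jc' F)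
    (n : ℕ) {K : Set ({w : InfinitePlace L // IsComplex w} → Fin 3 → ℝ)} (hK : IsCompact K) :
    BddAbove ((fun c => ‖iteratedFDeriv ℝ n (transfFamReg L α μ F S) c‖) '' (K ∩ RegG S)) :=
  bddAbove_norm_iteratedFDeriv_transfFamReg L α μ hμω hS (hF.2.2.1 S).1 (fun n K hK => (hF.2.2.1 S).2.1 n K hK) n hK

end Transf

end Literature.NumberTheory.Rogawski1990

end
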